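import Mathlib
import HarnessLib
import Summits.Ventures.LatticeQCDFlow.Exactness.ComplexSphereAction
import Summits.Ventures.LatticeQCDFlow.Exactness.CabibboMarinari

/-!
# Coordinate subgroups of `SU(N)` and the SU(2) subgroup of a coordinate pair

HONEST FRAMING: exact (Metropolis-corrected) sampling algorithms for lattice gauge theory;
figures of merit are autocorrelation/cost numbers at stated couplings and volumes; no
continuum-physics claim.

Venture `LatticeQCDFlow` (cell pub-lqcd), topic `Exactness`, FANOUT row 9 (eng-latcore, the
engine `latflow.core`: `update_link` in `csrc/latcore_template.c` runs, for `N ≥ 3`, one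
Cabibbo–Marinari heat-bath hit per coordinate pair `(i, j)`, `i < j`, lexicographically).  NEW WORK
of the cell over Mathlib and row 9's earlier files; nothing is cited as a fact.  Part of the
groundwork of the ergodicity proof for the SU(N) heat bath (`CabibboMarinariKernel.lean` and
`HeatBathSweepErgodic.lean` list "SU(N ≥ 3) Cabibbo–Marinari ergodicity" as NOT CLAIMED: one
subgroup hit does not dominate a Haar refresh).  The plan: the convolution of the embedded SU(2)
Haar measures over the lexicographic pairs dominates a multiple of Haar on `SU(N)` (induction over
coordinate subgroups through their orbit laws on spheres), hence the link update is Doeblin.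
Builds on `ComplexSphereAction.lean` (the action, `orbMap`) and `CabibboMarinari.lean` (`blockEmbSU`,
`quatOf`, `IsQuat`).

## What is proved (`n` a finite index type)

* §3 **`coordSubgroup s`** (`s : Finset n`) — the matrices of `SU(N)` that are the identity outside
  the rows and columns indexed by `s` (a copy of `SU(|s|)`); closed, compact; `coordSubgroup_mono`,
  `coordSubgroup_univ = ⊤`; `mulVec_apply_of_not_mem` / `mulVec_single_of_not_mem` /
  `mulVec_supported` (it fixes the coordinates outside `s`); **`inv_mul_mem_coordSubgroup_erase`**:
  two elements of `coordSubgroup s` giving `e_i` the same image differ by an element of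
  `coordSubgroup (s.erase i)` (the stabiliser; a unitary matrix with column `i = e_i` has row
  `i = e_i`, by `gᴴ g = 1`).
* §4 `pairFrame a b : n ≃ Fin 2 ⊕ {x // x ≠ a ∧ x ≠ b}` and **`pairHom a b = blockEmbSU (pairFrame a b)`**
  — the engine's SU(2) subgroup of the ordered pair `(a, b)`; its entries
  (`pairHom_apply_col_left/_col_of_ne/_row_of_ne`); `pairHom_mem_coordSubgroup` (it lies in
  `coordSubgroup {a, b}`); **`pairHom_mulVec_single`** (it sends `e_a` to `A₀₀ e_a + A₁₀ e_b`);
  `su2OfUnit x y` (the SU(2) matrix `[[x, −ȳ], [y, x̄]]` with a prescribed unit first column).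

NOT CLAIMED here: transitivity (next file), anything measure-theoretic.
-/

namespace Summit.Ventures.LatticeQCDFlow.Exactness

open Matrix MeasureTheory WithLp Metric Complex

variable {n : Type*} [Fintype n] [DecidableEq n]

/-! ## §3 Coordinate subgroups -/

section Coord

/-- **The coordinate subgroup of `s`**: the elements of `SU(N)` whose rows and columns outside `s`
are those of the identity matrix (a copy of `SU(|s|)` acting on the coordinates in `s`). -/
def coordSubgroup (s : Finset n) : Subgroup (Matrix.specialUnitaryGroup n ℂ) where
  carrier := {g | ∀ a ∉ s, ∀ b, ((g : Matrix n n ℂ) b a = if b = a then 1 else 0) ∧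
    ((g : Matrix n n ℂ) a b = if a = b then 1 else 0)}
  mul_mem' := by
    intro g h hg hh a ha b
    refine ⟨?_, ?_⟩
    · rw [Submonoid.coe_mul, Matrix.mul_apply, Finset.sum_eq_single a]
      · rw [(hh a ha a).1, if_pos rfl, mul_one, (hg a ha b).1]
      · intro c _ hca; rw [(hh a ha c).1, if_neg hca, mul_zero]
      · intro h'; exact absurd (Finset.mem_univ a) h'
    · rw [Submonoid.coe_mul, Matrix.mul_apply, Finset.sum_eq_single a]
      · rw [(hg a ha a).2, if_pos rfl, one_mul, (hh a ha b).2]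
      · intro c _ hca; rw [(hg a ha c).2, if_neg (Ne.symm hca), zero_mul]
      · intro h'; exact absurd (Finset.mem_univ a) h'
  one_mem' := by
    intro a _ b
    rw [OneMemClass.coe_one]
    exact ⟨Matrix.one_apply, Matrix.one_apply⟩
  inv_mem' := by
    intro g hg a ha b
    rw [← Matrix.star_eq_inv, Matrix.specialUnitaryGroup.coe_star, Matrix.star_apply,
      Matrix.star_apply, (hg a ha b).2, (hg a ha b).1]
    refine ⟨?_, ?_⟩
    · by_cases hab : a = b
      · rw [if_pos hab, if_pos hab.symm, star_one]
      · rw [if_neg hab, if_neg (Ne.symm hab), star_zero]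
    · by_cases hab : b = a
      · rw [if_pos hab, if_pos hab.symm, star_one]
      · rw [if_neg hab, if_neg (Ne.symm hab), star_zero]

/-- Membership, unfolded. -/
theorem mem_coordSubgroup_iff {s : Finset n} {g : Matrix.specialUnitaryGroup n ℂ} :
    g ∈ coordSubgroup s ↔ ∀ a ∉ s, ∀ b, ((g : Matrix n n ℂ) b a = if b = a then 1 else 0) ∧
      ((g : Matrix n n ℂ) a b = if a = b then 1 else 0) := Iff.rfl

/-- Larger coordinate sets give larger subgroups. -/
theorem coordSubgroup_mono {s t : Finset n} (hst : s ⊆ t) : coordSubgroup s ≤ coordSubgroup t :=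
  fun _ hg a ha b => hg a (fun h => ha (hst h)) b

/-- All coordinates: the whole group. -/
theorem coordSubgroup_univ : coordSubgroup (Finset.univ : Finset n) = ⊤ := by
  ext g
  simp [mem_coordSubgroup_iff]

/-- The coordinate subgroup is closed … -/
theorem isClosed_coordSubgroup (s : Finset n) :
    IsClosed (coordSubgroup s : Set (Matrix.specialUnitaryGroup n ℂ)) := by
  have h : (coordSubgroup s : Set (Matrix.specialUnitaryGroup n ℂ)) =
      ⋂ a ∈ (sᶜ : Finset n), ⋂ b : n,
        ({g : Matrix.specialUnitaryGroup n ℂ | (g : Matrix n n ℂ) b a = if b = a then 1 else 0} ∩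
          {g : Matrix.specialUnitaryGroup n ℂ | (g : Matrix n n ℂ) a b = if a = b then 1 else 0}) := by
    ext g
    simp only [SetLike.mem_coe, mem_coordSubgroup_iff, Finset.mem_compl, Set.mem_iInter,
      Set.mem_inter_iff, Set.mem_setOf_eq]
  rw [h]
  refine isClosed_biInter fun a _ => isClosed_iInter fun b => IsClosed.inter ?_ ?_
  · exact isClosed_eq ((continuous_apply_apply b a).comp continuous_subtype_val) continuous_const
  · exact isClosed_eq ((continuous_apply_apply a b).comp continuous_subtype_val) continuous_const

/-- … hence compact. -/
instance compactSpace_coordSubgroup (s : Finset n) : CompactSpace (coordSubgroup s) :=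
  isCompact_iff_compactSpace.1 (isClosed_coordSubgroup s).isCompact

/-- An element of `coordSubgroup s` FIXES the coordinates outside `s`: `(g z)_a = z_a`, and on `s` it
only reads coordinates in `s`. -/
theorem mulVec_apply_of_not_mem {s : Finset n} {g : Matrix.specialUnitaryGroup n ℂ}
    (hg : g ∈ coordSubgroup s) {a : n} (ha : a ∉ s) (z : n → ℂ) :
    ((g : Matrix n n ℂ) *ᵥ z) a = z a := by
  rw [Matrix.mulVec, dotProduct, Finset.sum_eq_single a]
  · rw [(hg a ha a).2, if_pos rfl, one_mul]
  · intro b _ hba; rw [(hg a ha b).2, if_neg (Ne.symm hba), zero_mul]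
  · intro h; exact absurd (Finset.mem_univ a) h

/-- An element of `coordSubgroup s` fixes `e_a` for `a ∉ s`. -/
theorem mulVec_single_of_not_mem {s : Finset n} {g : Matrix.specialUnitaryGroup n ℂ}
    (hg : g ∈ coordSubgroup s) {a : n} (ha : a ∉ s) :
    (g : Matrix n n ℂ) *ᵥ Pi.single a 1 = Pi.single a 1 := by
  rw [mulVec_single_one]
  funext b
  rw [(hg a ha b).1, Pi.single_apply]

/-- An element of `coordSubgroup s` preserves "supported in `s`". -/
theorem mulVec_supported {s : Finset n} {g : Matrix.specialUnitaryGroup n ℂ}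
    (hg : g ∈ coordSubgroup s) {z : n → ℂ} (hz : ∀ a ∉ s, z a = 0) :
    ∀ a ∉ s, ((g : Matrix n n ℂ) *ᵥ z) a = 0 := fun a ha => by
  rw [mulVec_apply_of_not_mem hg ha, hz a ha]

/-- **The stabiliser of `e_i` inside `coordSubgroup s` is `coordSubgroup (s.erase i)`**: two
elements of `coordSubgroup s` giving `e_i` the same image differ by an element of
`coordSubgroup (s.erase i)` (a unitary matrix with column `i` equal to `e_i` has row `i` equal to
`e_i`, by `gᴴ g = 1`). -/
theorem inv_mul_mem_coordSubgroup_erase {s : Finset n} {i : n} {g g' : Matrix.specialUnitaryGroup n ℂ}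
    (hg : g ∈ coordSubgroup s) (hg' : g' ∈ coordSubgroup s) (h : orbMap i g = orbMap i g') :
    g⁻¹ * g' ∈ coordSubgroup (s.erase i) := by
  set k := g⁻¹ * g' with hk
  have hks : k ∈ coordSubgroup s := (coordSubgroup s).mul_mem ((coordSubgroup s).inv_mem hg) hg'
  -- column `i` of `k` is `e_i`
  have hcol : ∀ b, (k : Matrix n n ℂ) b i = if b = i then 1 else 0 := by
    have h1 : orbMap i k = bpt i := by
      rw [hk, orbMap_mul, ← h, ← orbMap_mul, inv_mul_cancel, orbMap, actSU_one]
    have h2 := congrArg (fun p : S n => cplx (p : E n)) h1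
    simp only [cplx_orbMap, cplx_bpt] at h2
    intro b
    have := congrFun h2 b
    rw [this, Pi.single_apply]
  -- row `i` of `k` is `e_i`: `k i b = conj ((k⁻¹) b i)` and `k⁻¹` also has column `i` = `e_i`
  have hrow : ∀ b, (k : Matrix n n ℂ) i b = if i = b then 1 else 0 := by
    intro b
    have hinv : ∀ c, ((k⁻¹ : Matrix.specialUnitaryGroup n ℂ) : Matrix n n ℂ) c i =
        if c = i then 1 else 0 := by
      intro c
      -- `k⁻¹ k = 1`, column i: (k⁻¹ k) c i = Σ_d k⁻¹ c d k d i = k⁻¹ c i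
      have hm : (((k⁻¹ * k : Matrix.specialUnitaryGroup n ℂ)) : Matrix n n ℂ) c i =
          if c = i then 1 else 0 := by
        rw [inv_mul_cancel]; simp [Matrix.one_apply]
      rw [Submonoid.coe_mul, Matrix.mul_apply, Finset.sum_eq_single i] at hm
      · rwa [hcol i, if_pos rfl, mul_one] at hm
      · intro d _ hdi; rw [hcol d, if_neg hdi, mul_zero]
      · intro h'; exact absurd (Finset.mem_univ i) h'
    have hstar : (k : Matrix n n ℂ) i b =
        star (((k⁻¹ : Matrix.specialUnitaryGroup n ℂ) : Matrix n n ℂ) b i) := by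
      rw [← Matrix.star_eq_inv, Matrix.specialUnitaryGroup.coe_star, Matrix.star_apply, star_star]
    rw [hstar, hinv b]
    by_cases hib : i = b
    · rw [if_pos hib, if_pos hib.symm, star_one]
    · rw [if_neg hib, if_neg (Ne.symm hib), star_zero]
  intro a ha b
  by_cases hai : a = i
  · subst hai
    exact ⟨hcol b, hrow b⟩
  · have has : a ∉ s := fun h' => ha (Finset.mem_erase.2 ⟨hai, h'⟩)
    exact hks a has b

end Coord

/-! ## §4 The SU(2) subgroup of a coordinate pair -/

section Pair

variable (a b : n) (hab : a ≠ b)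

/-- **The frame of the ordered coordinate pair `(a, b)`**: `a ↦ inl 0`, `b ↦ inl 1`, the rest to
itself (the `e : n ≃ Fin 2 ⊕ m` of `CabibboMarinari.lean` for the engine's subgroup `(i, j)`). -/
def pairFrame : n ≃ Fin 2 ⊕ {x : n // x ≠ a ∧ x ≠ b} where
  toFun x := if hxa : x = a then Sum.inl 0 else if hxb : x = b then Sum.inl 1 else Sum.inr ⟨x, hxa, hxb⟩
  invFun := Sum.elim (fun k => if k = 0 then a else b) (fun y => y.1)
  left_inv x := by
    by_cases hxa : x = a
    · simp [hxa]
    · by_cases hxb : x = b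
      · simp [hxb, hab.symm]
      · simp [hxa, hxb]
  right_inv y := by
    rcases y with k | y
    · fin_cases k
      · simp
      · simp [hab.symm]
    · simp [y.2.1, y.2.2]

omit [Fintype n] in
/-- The frame sends `a` to `inl 0`. -/
@[simp] theorem pairFrame_apply_left : pairFrame a b hab a = Sum.inl 0 := by
  simp [pairFrame]

omit [Fintype n] in
/-- The frame sends `b` to `inl 1`. -/
@[simp] theorem pairFrame_apply_right : pairFrame a b hab b = Sum.inl 1 := by
  simp [pairFrame, hab.symm]

omit [Fintype n] in
/-- The frame sends every other index to itself on the right. -/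
theorem pairFrame_apply_of_ne {x : n} (hxa : x ≠ a) (hxb : x ≠ b) :
    pairFrame a b hab x = Sum.inr ⟨x, hxa, hxb⟩ := by
  simp [pairFrame, hxa, hxb]

/-- **The engine's SU(2) subgroup of the pair `(a, b)`**: `blockEmbSU` in the frame `pairFrame a b`. -/
def pairHom : Matrix.specialUnitaryGroup (Fin 2) ℂ →* Matrix.specialUnitaryGroup n ℂ :=
  blockEmbSU (pairFrame a b hab)

/-- The pair homomorphism is measurable (it is continuous). -/
theorem measurable_pairHom : Measurable (pairHom a b hab) := measurable_blockEmbSU _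

/-- Entries of the embedded matrix: column `a`. -/
theorem pairHom_apply_col_left (A : Matrix.specialUnitaryGroup (Fin 2) ℂ) (x : n) :
    (pairHom a b hab A : Matrix n n ℂ) x a =
      if x = a then (A : Matrix (Fin 2) (Fin 2) ℂ) 0 0 else
        if x = b then (A : Matrix (Fin 2) (Fin 2) ℂ) 1 0 else 0 := by
  change blockEmb (pairFrame a b hab) (A : Matrix (Fin 2) (Fin 2) ℂ) x a = _
  rw [blockEmb, Matrix.submatrix_apply, pairFrame_apply_left]
  by_cases hxa : x = a
  · subst hxa; simp
  · by_cases hxb : x = b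
    · subst hxb; simp [hxa]
    · rw [pairFrame_apply_of_ne a b hab hxa hxb]; simp [hxa, hxb]

/-- Entries of the embedded matrix outside the pair: those of the identity (column form). -/
theorem pairHom_apply_col_of_ne (A : Matrix.specialUnitaryGroup (Fin 2) ℂ) {c : n} (hca : c ≠ a)
    (hcb : c ≠ b) (x : n) :
    (pairHom a b hab A : Matrix n n ℂ) x c = if x = c then 1 else 0 := by
  change blockEmb (pairFrame a b hab) (A : Matrix (Fin 2) (Fin 2) ℂ) x c = _
  rw [blockEmb, Matrix.submatrix_apply, pairFrame_apply_of_ne a b hab hca hcb]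
  by_cases hxa : x = a
  · subst hxa; simp [Ne.symm hca]
  · by_cases hxb : x = b
    · subst hxb; simp [Ne.symm hcb]
    · rw [pairFrame_apply_of_ne a b hab hxa hxb, Matrix.fromBlocks_apply₂₂, Matrix.one_apply]
      by_cases hxc : x = c
      · subst hxc; simp
      · rw [if_neg hxc, if_neg]; exact fun h => hxc (congrArg Subtype.val h)

/-- Entries outside the pair, row form. -/
theorem pairHom_apply_row_of_ne (A : Matrix.specialUnitaryGroup (Fin 2) ℂ) {c : n} (hca : c ≠ a)
    (hcb : c ≠ b) (x : n) :
    (pairHom a b hab A : Matrix n n ℂ) c x = if c = x then 1 else 0 := by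
  change blockEmb (pairFrame a b hab) (A : Matrix (Fin 2) (Fin 2) ℂ) c x = _
  rw [blockEmb, Matrix.submatrix_apply, pairFrame_apply_of_ne a b hab hca hcb]
  by_cases hxa : x = a
  · subst hxa; simp [hca]
  · by_cases hxb : x = b
    · subst hxb; simp [hcb]
    · rw [pairFrame_apply_of_ne a b hab hxa hxb, Matrix.fromBlocks_apply₂₂, Matrix.one_apply]
      by_cases hxc : c = x
      · subst hxc; simp
      · rw [if_neg hxc, if_neg]; exact fun h => hxc (congrArg Subtype.val h)

/-- **The pair subgroup lies in the coordinate subgroup of `{a, b}`.** -/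
theorem pairHom_mem_coordSubgroup (A : Matrix.specialUnitaryGroup (Fin 2) ℂ) :
    pairHom a b hab A ∈ coordSubgroup ({a, b} : Finset n) := by
  intro c hc x
  have hca : c ≠ a := fun h => hc (by simp [h])
  have hcb : c ≠ b := fun h => hc (by simp [h])
  exact ⟨pairHom_apply_col_of_ne a b hab A hca hcb x, pairHom_apply_row_of_ne a b hab A hca hcb x⟩

/-- **The pair element sends `e_a` to `A₀₀ e_a + A₁₀ e_b`.** -/
theorem pairHom_mulVec_single (A : Matrix.specialUnitaryGroup (Fin 2) ℂ) :
    (pairHom a b hab A : Matrix n n ℂ) *ᵥ Pi.single a 1 =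
      (A : Matrix (Fin 2) (Fin 2) ℂ) 0 0 • (Pi.single a 1 : n → ℂ) +
        (A : Matrix (Fin 2) (Fin 2) ℂ) 1 0 • (Pi.single b 1 : n → ℂ) := by
  rw [mulVec_single_one]
  funext x
  rw [pairHom_apply_col_left]
  by_cases hxa : x = a
  · subst hxa; simp [hab]
  · by_cases hxb : x = b
    · subst hxb; simp [hxa]
    · simp [hxa, hxb]

/-- **The SU(2) matrix `[[x, −ȳ], [y, x̄]]` with a prescribed unit first column `(x, y)`.** -/
def su2OfUnit (x y : ℂ) (h : Complex.normSq x + Complex.normSq y = 1) :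
    Matrix.specialUnitaryGroup (Fin 2) ℂ :=
  ⟨quatOf x (-(starRingEnd ℂ) y), by
    have hq : IsQuat (quatOf x (-(starRingEnd ℂ) y)) := isQuat_quatOf _ _
    have hn : IsQuat.normSq (quatOf x (-(starRingEnd ℂ) y)) = 1 := by
      rw [IsQuat.normSq]; simpa [quatOf] using h
    rw [Matrix.mem_specialUnitaryGroup_iff, Matrix.mem_unitaryGroup_iff, Matrix.star_eq_conjTranspose,
      hq.mul_conjTranspose_self, hn, hq.det_eq, hn]
    simp⟩

/-- Its `(0,0)` entry is `x`. -/
@[simp] theorem su2OfUnit_apply_00 (x y : ℂ) (h : Complex.normSq x + Complex.normSq y = 1) :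
    (su2OfUnit x y h : Matrix (Fin 2) (Fin 2) ℂ) 0 0 = x := by
  simp [su2OfUnit, quatOf]

/-- Its `(1,0)` entry is `y`. -/
@[simp] theorem su2OfUnit_apply_10 (x y : ℂ) (h : Complex.normSq x + Complex.normSq y = 1) :
    (su2OfUnit x y h : Matrix (Fin 2) (Fin 2) ℂ) 1 0 = y := by
  simp [su2OfUnit, quatOf]

end Pair

end Summit.Ventures.LatticeQCDFlow.Exactness
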